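/-
Copyright (c) 2026 the pub-hodgecm-mathlib formalisation cell (harness21).  Prover seat hodgecm-mathlib-B-p04 (g34) — EP PEN of (R2) (LEAD F0P3a-plan (g9)
WORD T8-167; LEAD F0P3a-plan (g10) WORD T9-8 (C) «B-p04 keeps (R3)(R5)+assembly»), 2026-09-01.  FILE (R5b) of the Euler–Poincaré road for
`stub_N6nsR2EP : RankOneEulerPoincareNonsplit`: the TYPE-(1) IWAHORI EDGE COUNT at an unramified non-split CM place.
-/
import Literature.NumberTheory.Automorphic.UnitaryTwoIwahoriEdgeCountFibrewise
import Literature.NumberTheory.Automorphic.SelfDualStableLatticeInteriorCount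
import Literature.NumberTheory.Automorphic.SelfDualLatticeScalarReductionTransport
import HarnessLib

/-!
# Kottwitz's type-(1) edge count at an unramified non-split place: `E(γ) + 1 = Σ_{j ≤ N} w(q_v, j)`

Topic `NumberTheory/Automorphic`, namespace `Literature.NumberTheory.Automorphic` (+ `.UnitaryGroup` at the CM place).  THEOREMS ONLY: no definition, no
named fact, no instance, no notation, no `sorry`; kernel lane.  FILE (R5b) of the EP road (census `CENSUS-R2EP-RankOneEulerPoincare.B-p04g34.md` (2e)):
the type-(1) `(E)` relation of the glue ★ `RankOneEulerPoincareGlue.exists_eulerPoincare_of_relations` read at one place `w`.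

THE MATHEMATICS.  `L` CM, `v` a finite place of `L⁺` UNRAMIFIED and NON-SPLIT in `L`, `w ∣ v` (`c • w = w`), `σ_w`, `ϖ_w = ι_w(ϖ_v)`, `q_v = |𝓞_{L⁺} ∕ v|`;
`U_w = U(σ_w, (Φ₂)_w) ≤ GL₂(L_w)`, `K_U = U_w ∩ GL₂(𝒪_w)` (the self-dual vertex), `I_U = U_w ∩ Iwahori` (the edge `{𝒪², ϖ⁻¹𝒪 ⊕ 𝒪}`; ★ B-p10
`glInt_subgroupOf_inf_map_conj_glDiagonal_subgroupOf_eq`: `K_U ⊓ K′_U = I_U`).  For a TYPE-(1) elliptic regular `γ ∈ U_w` — eigenframe `γ P = P diag(u₀, u₁)`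
over `L_w`, `u₀ ≠ u₁` of norm one, `|u₀ − u₁| = |ϖ^N|` — the number `E(γ) = #Fix_γ(U_w ⧸ I_U)` of `γ`-fixed EDGES of the tree of `U(1,1)` satisfies
**`E(γ) + 1 = Σ_{j ≤ N} w(q_v, j)`** (`w(0) = 1`, `w(j) = q^{j−1}(q+1)`), i.e. with ★ A-p03 `ncard_selfDualStable_add_ncard_modularStable_antidiagTwo_eq_sum_at`
(`V_K + V_{K′} = Σ_{j ≤ N} w`) Kottwitz's `V_K + V_{K′} − E = χ(X^γ) = 1` [Kottwitz1988, §2] for the rank-one Euler–Poincaré function of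
[Rogawski1990, §12.6–12.7].  PROOF (`natCard_fixedBy_iwahori_add_one_eq_sum_at`): `N = 0` ⇒ `E = 0` (★ R5a); `N ≥ 1` ⇒ `E = V(N) + q_v · A` (★ R5a with
`#{τ t = −t} = q_v`, ★ `natCard_antifixed_residueField_eq`), where `V(N) = #Fix_γ(U_w ⧸ K_U) = Σ_{j ≤ N, j ≡ e} w` (★ `natCard_fixedBy_unitary_eq_ncard`, ★ B-p10
(L5) `exists_ncard_selfDualStable_antidiagTwo_eq_zpow_smul_one` + `ncard_selfDualStable_zpow_smul_one_eq_sum_at`) and `A = #{x : k_x ≡ u₁·1 (mod 𝓂)} =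
Σ_{j ≤ N−1, j ≡ e} w` (★ B-p08 `natCard_fixedBy_unitary_subtype_eq_ncard` + ★ A-p03 `exists_ncard_selfDualStable_scalarReduction_antidiagTwo_eq_sum_at`, same
parity bit `e`), and the arithmetic `V_e(N) + q·V_e(N−1) + 1 = Σ_{j ≤ N} w` (`sum_filter_mod_two_add_mul_add_one`: `q·w(j) = w(j+1)` for `j ≥ 1`,
`q·w(0) + 1 = w(1)`, `w(0) = 1`).  The main theorem runs at `maxHeartbeats 400000` (one `isDefEq` through the `U_w ≤ GL₂(L_w)` tower in the
final rewrite; ★ A-p03 (R4) has the same budget at `w`).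
HONEST LABEL: HC_CM is proved only modulo the cell's remaining named inputs (hLiu418, h413) until rung 0 closes; this file is unconditional.

## References
* [Kottwitz1988] R. E. Kottwitz, *Tamagawa numbers*, Ann. of Math. 127 (1988), 629–646, §2 (`O_γ(f_EP) = χ(X^γ) = 1` for elliptic `γ`).
* [Rogawski1990] J. D. Rogawski, *Automorphic Representations of Unitary Groups in Three Variables* (1990), §12.6–12.7 pp. 174–176 (Lemma 12.7.1).
* [Serre1980Trees] J.-P. Serre, *Trees* (1980), Ch. II §1.1.
-/

set_option autoImplicit false

noncomputable section

open scoped ValuativeRel Matrix MatrixGroups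
open Matrix ValuativeRel Finset IsLocalRing NumberField IsDedekindDomain MulAction

namespace Literature.NumberTheory.Automorphic

/-! ## §1 The arithmetic `V_e(N) + q·V_e(N−1) + 1 = Σ_{j ≤ N} w(q, j)` -/

/-- **`Σ_{j ≤ N, j ≡ e} w(j) + q · Σ_{j ≤ N−1, j ≡ e} w(j) + 1 = Σ_{j ≤ N} w(j)`** for `N ≥ 1`, `e ∈ {0,1}`, `w(0) = 1`, `w(j) = q^{j−1}(q+1)`: the vertices of the
fixed ball `B(N)` of parity `e`, plus `q` times those of `B(N−1)`, plus one, are all vertices of `B(N)` (`q·w(j) = w(j+1)` for `j ≥ 1`, `q·w(0) + 1 = w(1)`).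
[cite: Kottwitz1988, §2] -/
theorem sum_filter_mod_two_add_mul_add_one (q : ℕ) {e N : ℕ} (he : e ≤ 1) (hN : 1 ≤ N) :
    (∑ j ∈ (range (N + 1)).filter (fun j => j % 2 = e), (if j = 0 then 1 else q ^ (j - 1) * (q + 1))) +
        q * (∑ j ∈ (range (N - 1 + 1)).filter (fun j => j % 2 = e), (if j = 0 then 1 else q ^ (j - 1) * (q + 1))) + 1 =
      ∑ j ∈ range (N + 1), (if j = 0 then 1 else q ^ (j - 1) * (q + 1)) := by
  set w : ℕ → ℕ := fun j => if j = 0 then 1 else q ^ (j - 1) * (q + 1) with hw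
  rw [Finset.sum_filter, Finset.sum_filter]
  set f : ℕ → ℕ := fun j => if j % 2 = e then w j else 0 with hf
  -- the two weight identities: `f(M+1) + q f(M) = w(M+1)` (`M ≥ 1`) and the base `f 0 + f 1 + q f 0 + 1 = w 0 + w 1`
  have key : ∀ M, 1 ≤ M → f (M + 1) + q * f M = w (M + 1) := by
    intro M hM
    have hwM1 : w (M + 1) = q ^ M * (q + 1) := by simp [hw]
    have hwM : w M = q ^ (M - 1) * (q + 1) := by simp [hw, show M ≠ 0 by omega]
    by_cases hpar : (M + 1) % 2 = e
    · have hpar' : ¬ M % 2 = e := by omega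
      simp [hf, hpar, hpar']
    · have hpar' : M % 2 = e := by omega
      simp only [hf, hpar, hpar', if_false, if_true, zero_add, hwM1, hwM]
      obtain ⟨m, rfl⟩ : ∃ m, M = m + 1 := ⟨M - 1, by omega⟩
      rw [Nat.add_sub_cancel, pow_succ]
      ring
  have base : f 0 + f 1 + q * f 0 + 1 = w 0 + w 1 := by
    interval_cases e <;> simp [hf, hw] <;> ring
  induction N, hN using Nat.le_induction with
  | base =>
    rw [show (1 : ℕ) - 1 + 1 = 1 from rfl, show (1 : ℕ) + 1 = 2 from rfl]
    simp only [Finset.sum_range_succ, Finset.sum_range_zero, zero_add]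
    linarith [base]
  | succ M hM ih =>
    rw [show M + 1 - 1 + 1 = M + 1 from by omega]
    rw [show M - 1 + 1 = M from by omega] at ih
    rw [Finset.sum_range_succ f (M + 1), Finset.sum_range_succ w (M + 1)]
    have h2 : q * ∑ j ∈ range (M + 1), f j = q * ∑ j ∈ range M, f j + q * f M := by rw [Finset.sum_range_succ, mul_add]
    have hk := key M hM
    linarith

/-- Two parity bits `e, e′ ≤ 1` characterised by the same proposition coincide. [cite: Kottwitz1988, §2] -/
theorem eq_of_iff_eq_zero {P : Prop} {e e' : ℕ} (he : e ≤ 1) (he' : e' ≤ 1) (h : P ↔ e = 0) (h' : P ↔ e' = 0) : e = e' := by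
  rcases Nat.le_one_iff_eq_zero_or_eq_one.1 he with rfl | rfl <;> rcases Nat.le_one_iff_eq_zero_or_eq_one.1 he' with rfl | rfl
  · rfl
  · exact absurd (h'.1 (h.2 rfl)) one_ne_zero
  · exact absurd (h.1 (h'.2 rfl)) one_ne_zero
  · rfl

namespace UnitaryGroup

open Literature.NumberTheory.Rogawski1990 Literature.NumberTheory.GaloisRepresentations

section CM

variable (L : Type) [Field L] [NumberField L] [IsCMField L] (v : HeightOneSpectrum (𝓞 ↥(maximalRealSubfield L)))
  (w : PlacesOver L v) (hw : IsCMField.complexConj L • w.1 = w.1)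

include hw in
/-- **THE VERTEX DICTIONARY AT `w`**: `#Fix_γ(U_w ⧸ K_U) = #S((Φ₂)_w, γ)` — the `γ`-fixed cosets of `U_w` modulo `K_U = U_w ∩ GL₂(𝒪_w)` are the `γ`-stable
SELF-DUAL lattices (★ `natCard_fixedBy_unitary_eq_ncard` + ★ `exists_mem_unitary_span_eq_iff_selfDual_of_nonsplit`: at an unramified non-split place the
`U_w`-orbit of `𝒪_w²` is the set of all self-dual lattices).  The `U_w`-level twin of ★ `natCard_fixedBy_eq_ncard_selfDualStable_antidiagTwo` (stated on the
CM carrier `U₂`). [cite: Kottwitz1988, §2] [cite: Rogawski1990, §12.6 p. 174] -/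
theorem natCard_fixedBy_glInt_eq_ncard_selfDualStable_at (hunr : Algebra.IsUnramifiedIn (𝓞 L) v.asIdeal)
    (γ : ↥(unitaryGroupOfForm (galAdicCompletionMap (L := L) (IsCMField.complexConj L) hw)
      (placeForm (Matrix.of fun i j : Fin 2 => if i.val + j.val + 1 = 2 then (1 : L) else 0) w.1))) :
    Nat.card (fixedBy (↥(unitaryGroupOfForm (galAdicCompletionMap (L := L) (IsCMField.complexConj L) hw)
        (placeForm (Matrix.of fun i j : Fin 2 => if i.val + j.val + 1 = 2 then (1 : L) else 0) w.1)) ⧸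
      (glInt 2 (w.1.adicCompletion L)).subgroupOf (unitaryGroupOfForm (galAdicCompletionMap (L := L) (IsCMField.complexConj L) hw)
        (placeForm (Matrix.of fun i j : Fin 2 => if i.val + j.val + 1 = 2 then (1 : L) else 0) w.1))) γ) =
      {Λ : Submodule 𝒪[w.1.adicCompletion L] (Fin 2 → w.1.adicCompletion L) |
        (∃ g : GL (Fin 2) (w.1.adicCompletion L),
          (∃ J' ∈ glInt 2 (w.1.adicCompletion L), (J' : Matrix (Fin 2) (Fin 2) (w.1.adicCompletion L)) =
            formCongr (galAdicCompletionMap (L := L) (IsCMField.complexConj L) hw) g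
              (placeForm (Matrix.of fun i j : Fin 2 => if i.val + j.val + 1 = 2 then (1 : L) else 0) w.1)) ∧
          Λ = Submodule.span 𝒪[w.1.adicCompletion L] (Set.range ((g : Matrix (Fin 2) (Fin 2) (w.1.adicCompletion L)))ᵀ)) ∧
        Λ.map ((Matrix.toLin' (((γ : ↥(unitaryGroupOfForm (galAdicCompletionMap (L := L) (IsCMField.complexConj L) hw)
          (placeForm (Matrix.of fun i j : Fin 2 => if i.val + j.val + 1 = 2 then (1 : L) else 0) w.1))) :
            GL (Fin 2) (w.1.adicCompletion L)) : Matrix (Fin 2) (Fin 2) (w.1.adicCompletion L))).restrictScalars 𝒪[w.1.adicCompletion L]) = Λ}.ncard := by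
  have hc1 : IsCMField.complexConj L ≠ 1 := IsCMField.complexConj_ne_one L
  refine (natCard_fixedBy_unitary_eq_ncard (galAdicCompletionMap (L := L) (IsCMField.complexConj L) hw)
    (isUnit_placeForm_antidiagOne (E := L) 2 w.1).unit γ).trans ?_
  congr 1
  ext Λ
  exact and_congr_left' (exists_mem_unitary_span_eq_iff_selfDual_of_nonsplit L 2 _ hc1 w hw hunr (antidiagOne_isHermitian L 2)
    (isUnit_placeForm_antidiagOne (E := L) 2 w.1) (unit_placeForm_antidiagOne_mem_glInt (E := L) 2 w.1) Λ)

include hw in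
/-- **THE SCALAR-REDUCTION DICTIONARY AT `w`**: for `a ∈ 𝒪_w`, the `γ`-fixed vertices `x` whose monodromy `k_x = (out x)⁻¹ γ (out x)` is `≡ a·1 (mod 𝓂_w)`
are the `γ`-stable self-dual lattices `Λ` with `(γ − a·1)Λ ≤ ϖ_w Λ` (★ B-p08 `natCard_fixedBy_unitary_subtype_eq_ncard` + `units_inv_mul_sub_smul_one_mul`,
read through `residue = 0 ↔ valuation < 1`, + the self-dual orbit lemma). [cite: Kottwitz1988, §2] [cite: Rogawski1990, §12.6 p. 174] -/
theorem natCard_fixedBy_subtype_scalarReduction_eq_ncard_at (hunr : Algebra.IsUnramifiedIn (𝓞 L) v.asIdeal)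
    (γ : ↥(unitaryGroupOfForm (galAdicCompletionMap (L := L) (IsCMField.complexConj L) hw)
      (placeForm (Matrix.of fun i j : Fin 2 => if i.val + j.val + 1 = 2 then (1 : L) else 0) w.1))) {a : w.1.adicCompletion L}
    (ha : a ∈ 𝒪[w.1.adicCompletion L]) :
    Nat.card {x : fixedBy (↥(unitaryGroupOfForm (galAdicCompletionMap (L := L) (IsCMField.complexConj L) hw)
        (placeForm (Matrix.of fun i j : Fin 2 => if i.val + j.val + 1 = 2 then (1 : L) else 0) w.1)) ⧸
      (glInt 2 (w.1.adicCompletion L)).subgroupOf (unitaryGroupOfForm (galAdicCompletionMap (L := L) (IsCMField.complexConj L) hw)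
        (placeForm (Matrix.of fun i j : Fin 2 => if i.val + j.val + 1 = 2 then (1 : L) else 0) w.1))) γ //
        ∀ i j, valuation (w.1.adicCompletion L) (((((x.1.out)⁻¹ * γ * x.1.out :
          ↥(unitaryGroupOfForm (galAdicCompletionMap (L := L) (IsCMField.complexConj L) hw)
            (placeForm (Matrix.of fun i j : Fin 2 => if i.val + j.val + 1 = 2 then (1 : L) else 0) w.1))) : GL (Fin 2) (w.1.adicCompletion L)) :
          Matrix (Fin 2) (Fin 2) (w.1.adicCompletion L)) i j - (a • (1 : Matrix (Fin 2) (Fin 2) (w.1.adicCompletion L))) i j) < 1} =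
      {Λ : Submodule 𝒪[w.1.adicCompletion L] (Fin 2 → w.1.adicCompletion L) |
        ((∃ g : GL (Fin 2) (w.1.adicCompletion L),
            (∃ J' ∈ glInt 2 (w.1.adicCompletion L), (J' : Matrix (Fin 2) (Fin 2) (w.1.adicCompletion L)) =
              formCongr (galAdicCompletionMap (L := L) (IsCMField.complexConj L) hw) g
                (placeForm (Matrix.of fun i j : Fin 2 => if i.val + j.val + 1 = 2 then (1 : L) else 0) w.1)) ∧
            Λ = Submodule.span 𝒪[w.1.adicCompletion L] (Set.range ((g : Matrix (Fin 2) (Fin 2) (w.1.adicCompletion L)))ᵀ)) ∧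
          Λ.map ((Matrix.toLin' (((γ : ↥(unitaryGroupOfForm (galAdicCompletionMap (L := L) (IsCMField.complexConj L) hw)
            (placeForm (Matrix.of fun i j : Fin 2 => if i.val + j.val + 1 = 2 then (1 : L) else 0) w.1))) :
              GL (Fin 2) (w.1.adicCompletion L)) : Matrix (Fin 2) (Fin 2) (w.1.adicCompletion L))).restrictScalars 𝒪[w.1.adicCompletion L]) = Λ) ∧
        Λ.map ((Matrix.toLin' ((((γ : ↥(unitaryGroupOfForm (galAdicCompletionMap (L := L) (IsCMField.complexConj L) hw)
            (placeForm (Matrix.of fun i j : Fin 2 => if i.val + j.val + 1 = 2 then (1 : L) else 0) w.1))) :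
              GL (Fin 2) (w.1.adicCompletion L)) : Matrix (Fin 2) (Fin 2) (w.1.adicCompletion L)) - a • 1)).restrictScalars 𝒪[w.1.adicCompletion L]) ≤
          Λ.map ((Matrix.toLin' ((toPlace v w (HeckeCharacter.uniformizer ↥(maximalRealSubfield L) v : v.adicCompletion ↥(maximalRealSubfield L))) •
            (1 : Matrix (Fin 2) (Fin 2) (w.1.adicCompletion L)))).restrictScalars 𝒪[w.1.adicCompletion L])}.ncard := by
  have hc1 : IsCMField.complexConj L ≠ 1 := IsCMField.complexConj_ne_one L
  have hϖv := Liu2021.LemD1IndexedNonVacuityInertCofinite.valued_toPlace_uniformizer_of_isUnramifiedIn L v hunr w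
  have hϖ : IsUniformizingElement
      (toPlace v w (HeckeCharacter.uniformizer ↥(maximalRealSubfield L) v : v.adicCompletion ↥(maximalRealSubfield L))) :=
    isUniformizingElement_of_v_eq hϖv
  refine Eq.trans ?_ ((natCard_fixedBy_unitary_subtype_eq_ncard (galAdicCompletionMap (L := L) (IsCMField.complexConj L) hw) _ γ
    ((((γ : ↥(unitaryGroupOfForm (galAdicCompletionMap (L := L) (IsCMField.complexConj L) hw)
      (placeForm (Matrix.of fun i j : Fin 2 => if i.val + j.val + 1 = 2 then (1 : L) else 0) w.1))) :
        GL (Fin 2) (w.1.adicCompletion L)) : Matrix (Fin 2) (Fin 2) (w.1.adicCompletion L)) - a • 1) hϖ.ne_zero).trans ?_)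
  · -- the two readings of «`k_x ≡ a·1 (mod 𝓂)`»
    refine Nat.card_congr (Equiv.subtypeEquivRight fun x => ?_)
    have hk := Subgroup.mem_subgroupOf.1 (inv_mul_mul_mem_of_smul_eq Quotient.out (fun y => Quotient.out_eq y) γ x.2)
    rw [units_inv_mul_sub_smul_one_mul, ← Units.val_mul, ← Units.val_mul, ← Subgroup.coe_inv, ← Subgroup.coe_mul, ← Subgroup.coe_mul]
    refine forall_congr' fun i => forall_congr' fun j => ?_
    have hint := sub_mem (apply_mem_integer_of_mem_glInt hk i j) (smul_one_apply_mem_integer ⟨a, ha⟩ i j)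
    rw [← residue_eq_zero_iff_valuation_lt_one ⟨_, hint⟩, ← hϖ.inv_mul_mem_iff]
    exact Iff.rfl
  · congr 1
    ext Λ
    exact and_congr_left' (and_congr_left' (exists_mem_unitary_span_eq_iff_selfDual_of_nonsplit L 2 _ hc1 w hw hunr (antidiagOne_isHermitian L 2)
      (isUnit_placeForm_antidiagOne (E := L) 2 w.1) (unit_placeForm_antidiagOne_mem_glInt (E := L) 2 w.1) Λ))


include hw in
set_option maxHeartbeats 400000 in
/-- **KOTTWITZ'S TYPE-(1) EDGE COUNT AT `w`**: `v` unramified non-split, `γ ∈ U(σ_w, (Φ₂)_w)` with eigenframe `γ P = P diag(u₀, u₁)` over `L_w`, `u₀ ≠ u₁`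
of norm one, `|u₀ − u₁| = |ϖ_w^N|`: the `γ`-fixed EDGES of the tree of `U(Φ₂)_v` (`= Fix_γ(U_w ⧸ I_U)`, `I_U = U_w ∩ Iwahori`) number `Σ_{j ≤ N} w(q_v, j) − 1`.
With ★ `ncard_selfDualStable_add_ncard_modularStable_antidiagTwo_eq_sum_at` (`V_K + V_{K′} = Σ_{j ≤ N} w`) this is `V_K + V_{K′} − E = 1 = χ(X^γ)`.
[cite: Kottwitz1988, §2] [cite: Rogawski1990, §12.6 p. 174; §12.7 Lemma 12.7.1 p. 176] -/
theorem natCard_fixedBy_iwahori_add_one_eq_sum_at (hunr : Algebra.IsUnramifiedIn (𝓞 L) v.asIdeal)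
    (γ : ↥(unitaryGroupOfForm (galAdicCompletionMap (L := L) (IsCMField.complexConj L) hw)
      (placeForm (Matrix.of fun i j : Fin 2 => if i.val + j.val + 1 = 2 then (1 : L) else 0) w.1)))
    {P : GL (Fin 2) (w.1.adicCompletion L)} {u : Fin 2 → w.1.adicCompletion L}
    (hP : (((γ : ↥(unitaryGroupOfForm (galAdicCompletionMap (L := L) (IsCMField.complexConj L) hw)
        (placeForm (Matrix.of fun i j : Fin 2 => if i.val + j.val + 1 = 2 then (1 : L) else 0) w.1))) : GL (Fin 2) (w.1.adicCompletion L)) :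
        Matrix (Fin 2) (Fin 2) (w.1.adicCompletion L)) * P = P * diagonal u)
    (hu : Function.Injective u) (hu1 : ∀ i, galAdicCompletionMap (L := L) (IsCMField.complexConj L) hw (u i) * u i = 1) {N : ℕ}
    (hN : valuation (w.1.adicCompletion L) (u 0 - u 1) =
      valuation (w.1.adicCompletion L) (toPlace v w (HeckeCharacter.uniformizer ↥(maximalRealSubfield L) v : v.adicCompletion ↥(maximalRealSubfield L)) ^ N)) :
    Nat.card (fixedBy (↥(unitaryGroupOfForm (galAdicCompletionMap (L := L) (IsCMField.complexConj L) hw)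
        (placeForm (Matrix.of fun i j : Fin 2 => if i.val + j.val + 1 = 2 then (1 : L) else 0) w.1)) ⧸
      (iwahoriGL 2 (w.1.adicCompletion L)).subgroupOf (unitaryGroupOfForm (galAdicCompletionMap (L := L) (IsCMField.complexConj L) hw)
        (placeForm (Matrix.of fun i j : Fin 2 => if i.val + j.val + 1 = 2 then (1 : L) else 0) w.1))) γ) + 1 =
      ∑ j ∈ range (N + 1),
        (if j = 0 then 1 else Nat.card (𝓞 ↥(maximalRealSubfield L) ⧸ v.asIdeal) ^ (j - 1) * (Nat.card (𝓞 ↥(maximalRealSubfield L) ⧸ v.asIdeal) + 1)) := by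
  classical
  have hJ : placeForm (Matrix.of fun i j : Fin 2 => if i.val + j.val + 1 = 2 then (1 : L) else 0) w.1 = !![(0 : w.1.adicCompletion L), 1; 1, 0] := by
    ext i j; fin_cases i <;> fin_cases j <;> simp [placeForm, Matrix.map_apply]
  -- the residue data at `w` (as in ★ (L5) `ncard_selfDualStable_zpow_smul_one_eq_sum_at`)
  have hc1 : IsCMField.complexConj L ≠ 1 := IsCMField.complexConj_ne_one L
  have hϖv := Liu2021.LemD1IndexedNonVacuityInertCofinite.valued_toPlace_uniformizer_of_isUnramifiedIn L v hunr w
  have hϖ : IsUniformizingElement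
      (toPlace v w (HeckeCharacter.uniformizer ↥(maximalRealSubfield L) v : v.adicCompletion ↥(maximalRealSubfield L))) :=
    isUniformizingElement_of_v_eq hϖv
  haveI : IsDiscreteValuationRing 𝒪[w.1.adicCompletion L] := isDiscreteValuationRing_integer_of_compatible hϖv
  have hσO : ∀ x : 𝒪[w.1.adicCompletion L], galAdicCompletionMap (L := L) (IsCMField.complexConj L) hw x ∈ 𝒪[w.1.adicCompletion L] :=
    mem_integer_galAdicCompletionMap (IsCMField.complexConj L) v w hw
  let σO : 𝒪[w.1.adicCompletion L] →+* 𝒪[w.1.adicCompletion L] :=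
    ((galAdicCompletionMap (L := L) (IsCMField.complexConj L) hw).comp (𝒪[w.1.adicCompletion L]).subtype).codRestrict 𝒪[w.1.adicCompletion L]
      fun x => hσO x
  have hσO' : ∀ x : 𝒪[w.1.adicCompletion L], ((σO x : 𝒪[w.1.adicCompletion L]) : w.1.adicCompletion L) =
      galAdicCompletionMap (L := L) (IsCMField.complexConj L) hw x := fun _ => rfl
  have hσσ : ∀ x, σO (σO x) = x := fun x =>
    Subtype.ext (galAdicCompletionMap_galAdicCompletionMap_of_smul_eq (IsCMField.complexConj L) w hc1 hw (x : w.1.adicCompletion L))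
  obtain ⟨σk, hσk⟩ := exists_residueField_ringHom_galAdicCompletionMap (IsCMField.complexConj L) v w hw
  have hτ : ∀ x : 𝒪[w.1.adicCompletion L],
      IsLocalRing.residue 𝒪[w.1.adicCompletion L] (σO x) = σk (IsLocalRing.residue 𝒪[w.1.adicCompletion L] x) := fun x => hσk x
  have hq : Nat.card 𝓀[w.1.adicCompletion L] = Nat.card (𝓞 ↥(maximalRealSubfield L) ⧸ v.asIdeal) ^ 2 :=
    natCard_residueField_eq_sq_of_inert (IsCMField.complexConj L) v hc1 hunr w hw
  letI : Fintype 𝓀[w.1.adicCompletion L] := Fintype.ofFinite _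
  have hq' : Fintype.card 𝓀[w.1.adicCompletion L] = Nat.card (𝓞 ↥(maximalRealSubfield L) ⧸ v.asIdeal) ^ 2 := by
    rw [← Nat.card_eq_fintype_card, hq]
  obtain ⟨a₀, ha₀⟩ := LocalFields.UnramifiedQuadraticNorm.exists_isUnit_map_sub_of_residueHom_ne
    (galAdicCompletionMap (L := L) (IsCMField.complexConj L) hw) hσO σk hσk
    (Literature.LinearAlgebra.Matrix.exists_frob_ne hq' σk (residueHom_galAdicCompletionMap_eq_pow (IsCMField.complexConj L) v hc1 hunr w hw σk hσO hσk))
  have ha₀' : IsUnit (σO a₀ - a₀) := ha₀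
  have hval : ∀ i, valuation (w.1.adicCompletion L) (u i) = 1 := fun i => valuation_eq_one_of_galAdicCompletionMap_mul_self L v w hw (hu1 i)
  have huO : ∀ i, u i ∈ 𝒪[w.1.adicCompletion L] := fun i => (Valuation.mem_integer_iff _ _).2 (hval i).le
  have hs : Nat.card {t : 𝓀[w.1.adicCompletion L] // σk t = -t} = Nat.card (𝓞 ↥(maximalRealSubfield L) ⧸ v.asIdeal) :=
    natCard_antifixed_residueField_eq σO hσσ ha₀' σk hτ hq
  rcases Nat.eq_zero_or_pos N with rfl | hNpos
  · -- `N = 0`: no fixed edge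
    rw [pow_zero, map_one] at hN
    rw [natCard_fixedBy_iwahori_eq_zero_of_valuation_sub_eq_one (galAdicCompletionMap (L := L) (IsCMField.complexConj L) hw) σO hσO' hσσ ha₀'
      σk hτ hJ γ hP huO hu1 hN]
    simp
  · have hN1 : 1 ≤ N := hNpos
    have hlt : valuation (w.1.adicCompletion L) (u 0 - u 1) < 1 := by
      rw [hN, map_pow]; exact hϖ.valuation_pow_lt_one hN1
    have hγ : ((γ : ↥(unitaryGroupOfForm (galAdicCompletionMap (L := L) (IsCMField.complexConj L) hw)
        (placeForm (Matrix.of fun i j : Fin 2 => if i.val + j.val + 1 = 2 then (1 : L) else 0) w.1))) : GL (Fin 2) (w.1.adicCompletion L)) ∈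
        Literature.AlgebraicGeometry.ShimuraVarieties.unitaryGroup (galAdicCompletionMap (L := L) (IsCMField.complexConj L) hw)
          (placeForm (Matrix.of fun i j : Fin 2 => if i.val + j.val + 1 = 2 then (1 : L) else 0) w.1) :=
      Literature.AlgebraicGeometry.ShimuraVarieties.mem_unitaryGroup_iff.2 (mem_unitaryGroupOfForm_iff.1 γ.2)
    -- `V(N) = #Fix_γ(U_w ⧸ K_U) = Σ_{j ≤ N, j ≡ e} w`
    obtain ⟨e, γ', he1, hpar, hγ', hcount⟩ := exists_ncard_selfDualStable_antidiagTwo_eq_zpow_smul_one L v w hw hunr hγ hP hu hu1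
    have hVsum := ncard_selfDualStable_zpow_smul_one_eq_sum_at L v w hw hunr hu1 hN he1 γ' hγ'
    have hV := natCard_fixedBy_glInt_eq_ncard_selfDualStable_at L v w hw hunr γ
    rw [hcount, hVsum] at hV
    -- the fixed vertices are finitely many: the term `j = e` is present
    haveI : Finite (fixedBy (↥(unitaryGroupOfForm (galAdicCompletionMap (L := L) (IsCMField.complexConj L) hw)
        (placeForm (Matrix.of fun i j : Fin 2 => if i.val + j.val + 1 = 2 then (1 : L) else 0) w.1)) ⧸
      (glInt 2 (w.1.adicCompletion L)).subgroupOf (unitaryGroupOfForm (galAdicCompletionMap (L := L) (IsCMField.complexConj L) hw)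
        (placeForm (Matrix.of fun i j : Fin 2 => if i.val + j.val + 1 = 2 then (1 : L) else 0) w.1))) γ) := by
      apply Nat.finite_of_card_ne_zero
      rw [hV]
      refine Nat.pos_iff_ne_zero.1 (lt_of_lt_of_le ?_ (Finset.single_le_sum
        (f := fun j => if j = 0 then 1 else Nat.card (𝓞 ↥(maximalRealSubfield L) ⧸ v.asIdeal) ^ (j - 1) * (Nat.card (𝓞 ↥(maximalRealSubfield L) ⧸ v.asIdeal) + 1))
        (fun _ _ => Nat.zero_le _) (Finset.mem_filter.2 ⟨Finset.mem_range.2 (by omega), Nat.mod_eq_of_lt (by omega)⟩)))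
      split_ifs with h0
      · exact Nat.one_pos
      · rw [show e - 1 = 0 by omega, pow_zero, one_mul]
        exact Nat.succ_pos _
    -- `A = #{x : k_x ≡ u₁·1 (mod 𝓂)} = Σ_{j ≤ N−1, j ≡ e} w`
    obtain ⟨e', he1', hpar', hcount'⟩ := exists_ncard_selfDualStable_scalarReduction_antidiagTwo_eq_sum_at L v w hw hunr hγ hP hu hu1 hN1 hN
    have hee' : e' = e := (eq_of_iff_eq_zero he1 he1' hpar hpar').symm
    subst hee'
    have hA := natCard_fixedBy_subtype_scalarReduction_eq_ncard_at L v w hw hunr γ (huO 1)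
    rw [hcount'] at hA
    -- assemble
    rw [natCard_fixedBy_iwahori_eq_add_mul_of_valuation_sub_lt_one (galAdicCompletionMap (L := L) (IsCMField.complexConj L) hw) σO hσO' hσσ ha₀'
      σk hτ hJ γ hP huO hu1 hlt, hV, hs, hA]
    exact sum_filter_mod_two_add_mul_add_one _ he1 hN1

end CM

end UnitaryGroup

end Literature.NumberTheory.Automorphic
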